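import Summits.CriticalPhenomena.PercolationContinuityZ3.Theorems.PercNearOneGluingNoHeavyQuantThreePortBoxKit
import HarnessLib

/-!
# The three-port residual kit, VIII: vacuous boxes for a hair REGION (V-floor variants, `Σ ≤ 2` boxes, boxes outside the region)

builds on p205010 (kernel theorem, internal audit signed; external expert review pending)

Support file (`--supports stmt-CriticalPhenomena-4575`), seat `prim-quant-p1` (gen 5); memo `run/shared/lean/prim/quant/P1-SURPLUS.md` §16.
No definitions, no named facts, no sorries; standard axioms.  Pure real algebra.

The tiling of a hair REGION `{0 ≤ γ ≤ β ≤ α ≤ ½, V_a := β+γ−βγ−α ≥ v₀}` (all hair sizes; `V_a ≥ v₀` says the largest hair does not outweigh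
the union of the other two, margin `v₀`) needs, besides the chains with V-floors (`…BoxDTV`, `…BoxGZV`), three kinds of one-line leaves:
* `ThreePort.vacVBox_false` — a box lying outside the region (`max_box V_a < v₀`; corner bound `V_le_box`);
* `ThreePort.vacSBox_false` — a box of small hairs on which `Σ_v q_v ≤ s + C·(1 − U0) ≤ 2` for every cell vector (the hypothesis `Σ > 2`
  of `Z(3,2)` is unreachable), `C` = a common bound of the four cell coefficients (`cpair_le_box`, `c3_le_of_vertices`);
* `ThreePort.vacBoxV_{a,b,c}_false` — some `T_v⁻ ≤ 0` on the box while `V_v ≥ 0` is known from a HYPOTHESIS (in the sorted cone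
  `V_b, V_c ≥ V_a ≥ v₀ > 0`: `Vb_ge_Va`, `Vc_ge_Va`), so that exchange holds.
-/

noncomputable section

namespace Summit.CriticalPhenomena.PercolationContinuityZ3.Theorems

namespace ThreePort

/-! ### Corner upper bound for `V` and the sorted-cone comparisons -/

/-- `V(h;u,w) = u+w−uw−h` is at most its value at the corner `(lh, hu, hw)` (for `w, hu ≤ 1`). [this work] -/
theorem V_le_box (h u w lh hu hw : ℝ) (h1 : lh ≤ h) (h4 : u ≤ hu) (h6 : w ≤ hw) (hw1 : w ≤ 1) (hhu1 : hu ≤ 1) :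
    u + w - u * w - h ≤ hu + hw - hu * hw - lh := by
  have e : (hu + hw - hu * hw) - (u + w - u * w) = (hu - u) * (1 - w) + (hw - w) * (1 - hu) := by ring
  have : 0 ≤ (hu - u) * (1 - w) + (hw - w) * (1 - hu) :=
    add_nonneg (mul_nonneg (by linarith only [h4]) (by linarith only [hw1]))
      (mul_nonneg (by linarith only [h6]) (by linarith only [hhu1]))
  linarith only [e, this, h1]

/-- In the sorted cone `β ≤ α` (and `γ ≤ 2`): `V_a ≤ V_b`, since `V_b − V_a = (α−β)(2−γ)`. [this work] -/
theorem Vb_ge_Va (α β γ : ℝ) (hba : β ≤ α) (hγ : γ ≤ 2) : β + γ - β * γ - α ≤ α + γ - α * γ - β := by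
  have e : (α + γ - α * γ - β) - (β + γ - β * γ - α) = (α - β) * (2 - γ) := by ring
  have : 0 ≤ (α - β) * (2 - γ) := mul_nonneg (by linarith only [hba]) (by linarith only [hγ])
  linarith only [e, this]

/-- In the sorted cone `γ ≤ α` (and `β ≤ 2`): `V_a ≤ V_c`, since `V_c − V_a = (α−γ)(2−β)`. [this work] -/
theorem Vc_ge_Va (α β γ : ℝ) (hca : γ ≤ α) (hβ : β ≤ 2) : β + γ - β * γ - α ≤ α + β - α * β - γ := by
  have e : (α + β - α * β - γ) - (β + γ - β * γ - α) = (α - γ) * (2 - β) := by ring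
  have : 0 ≤ (α - γ) * (2 - β) := mul_nonneg (by linarith only [hca]) (by linarith only [hβ])
  linarith only [e, this]

/-! ### Boxes outside the region `V_a ≥ v₀` -/

/-- A box on which `V_a < v₀` everywhere carries no point of the region `V_a ≥ v₀`. [this work] -/
theorem vacVBox_false (α β γ la hb hc v0 : ℝ) (a1 : la ≤ α) (b2 : β ≤ hb) (c2 : γ ≤ hc)
    (hV : v0 ≤ β + γ - β * γ - α) (hnum : hc ≤ 1 ∧ hb ≤ 1 ∧ hb + hc - hb * hc - la < v0) : False := by
  obtain ⟨hhc, hhb, hlt⟩ := hnum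
  have := V_le_box α β γ la hb hc a1 b2 c2 (c2.trans hhc) hhb
  linarith only [this, hV, hlt]

/-! ### Boxes of small hairs: `Σ_v q_v ≤ 2` for every cell vector -/

/-- **`Σ ≤ 2` box.**  If `C` bounds the three pair coefficients and the eight vertex values of `c₃` on the box and `ha+hb+hc+C ≤ 2`, then
`Σ = s + Σ c_v U_v + c₃ U3 ≤ s + C(1 − U0) ≤ 2`, contradicting `Σ > 2`. [this work] -/
theorem vacSBox_false (α β γ U0 Uab Uac Ubc U3 la ha lb hb lc hc C : ℝ)
    (a1 : la ≤ α) (a2 : α ≤ ha) (b1 : lb ≤ β) (b2 : β ≤ hb) (c1 : lc ≤ γ) (c2 : γ ≤ hc)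
    (h0 : 0 ≤ U0) (hab : 0 ≤ Uab) (hac : 0 ≤ Uac) (hbc : 0 ≤ Ubc) (h3 : 0 ≤ U3)
    (hsum : Uab + Uac + Ubc + U3 + U0 = 1)
    (hSig : 2 < (α + β + γ) + (α + β - 2 * α * β) * Uab + (α + γ - 2 * α * γ) * Uac + (β + γ - 2 * β * γ) * Ubc +
      ((1 - α) * (β + γ - β * γ) + (1 - β) * (α + γ - α * γ) + (1 - γ) * (α + β - α * β)) * U3)
    (hnum : ha ≤ 1 / 2 ∧ hb ≤ 1 / 2 ∧ hc ≤ 1 / 2 ∧ 0 ≤ C ∧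
      ha + hb - 2 * ha * hb ≤ C ∧ ha + hc - 2 * ha * hc ≤ C ∧ hb + hc - 2 * hb * hc ≤ C ∧
      (1 - la) * (lb + lc - lb * lc) + (1 - lb) * (la + lc - la * lc) + (1 - lc) * (la + lb - la * lb) ≤ C ∧
      (1 - la) * (lb + hc - lb * hc) + (1 - lb) * (la + hc - la * hc) + (1 - hc) * (la + lb - la * lb) ≤ C ∧
      (1 - la) * (hb + lc - hb * lc) + (1 - hb) * (la + lc - la * lc) + (1 - lc) * (la + hb - la * hb) ≤ C ∧
      (1 - la) * (hb + hc - hb * hc) + (1 - hb) * (la + hc - la * hc) + (1 - hc) * (la + hb - la * hb) ≤ C ∧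
      (1 - ha) * (lb + lc - lb * lc) + (1 - lb) * (ha + lc - ha * lc) + (1 - lc) * (ha + lb - ha * lb) ≤ C ∧
      (1 - ha) * (lb + hc - lb * hc) + (1 - lb) * (ha + hc - ha * hc) + (1 - hc) * (ha + lb - ha * lb) ≤ C ∧
      (1 - ha) * (hb + lc - hb * lc) + (1 - hb) * (ha + lc - ha * lc) + (1 - lc) * (ha + hb - ha * hb) ≤ C ∧
      (1 - ha) * (hb + hc - hb * hc) + (1 - hb) * (ha + hc - ha * hc) + (1 - hc) * (ha + hb - ha * hb) ≤ C ∧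
      ha + hb + hc + C ≤ 2) : False := by
  obtain ⟨hha, hhb, hhc, hC0, pab, pac, pbc, v1, v2, v3, v4, v5, v6, v7, v8, hfin⟩ := hnum
  have hβh : β ≤ 1 / 2 := b2.trans hhb
  have hγh : γ ≤ 1 / 2 := c2.trans hhc
  have hcab : α + β - 2 * α * β ≤ C := (cpair_le_box α β ha hb a2 b2 hha hβh).trans pab
  have hcac : α + γ - 2 * α * γ ≤ C := (cpair_le_box α γ ha hc a2 c2 hha hγh).trans pac
  have hcbc : β + γ - 2 * β * γ ≤ C := (cpair_le_box β γ hb hc b2 c2 hhb hγh).trans pbc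
  have hc3 : (1 - α) * (β + γ - β * γ) + (1 - β) * (α + γ - α * γ) + (1 - γ) * (α + β - α * β) ≤ C :=
    c3_le_of_vertices α β γ la ha lb hb lc hc C a1 a2 b1 b2 c1 c2 v1 v2 v3 v4 v5 v6 v7 v8
  have t1 : (α + β - 2 * α * β) * Uab ≤ C * Uab := mul_le_mul_of_nonneg_right hcab hab
  have t2 : (α + γ - 2 * α * γ) * Uac ≤ C * Uac := mul_le_mul_of_nonneg_right hcac hac
  have t3 : (β + γ - 2 * β * γ) * Ubc ≤ C * Ubc := mul_le_mul_of_nonneg_right hcbc hbc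
  have t4 : ((1 - α) * (β + γ - β * γ) + (1 - β) * (α + γ - α * γ) + (1 - γ) * (α + β - α * β)) * U3 ≤ C * U3 :=
    mul_le_mul_of_nonneg_right hc3 h3
  have t5 : 0 ≤ C * U0 := mul_nonneg hC0 h0
  have e : C * Uab + C * Uac + C * Ubc + C * U3 = C - C * U0 := by
    have : Uab + Uac + Ubc + U3 = 1 - U0 := by linarith only [hsum]
    calc C * Uab + C * Uac + C * Ubc + C * U3 = C * (Uab + Uac + Ubc + U3) := by ring
      _ = C - C * U0 := by rw [this]; ring
  linarith only [hSig, t1, t2, t3, t4, t5, e, a2, b2, c2, hfin]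

/-! ### Vacuous exchanges with a V-floor from a hypothesis -/

/-- If `T_a⁻ ≤ 0` on the box and `V_a ≥ Va ≥ 0` (hypothesis), the exchange at `a` cannot fail. [this work] -/
theorem vacBoxV_a_false (α β γ U0 Ubc la ha lb hb lc hc Va : ℝ)
    (a1 : la ≤ α) (a2 : α ≤ ha) (b1 : lb ≤ β) (b2 : β ≤ hb) (c1 : lc ≤ γ) (c2 : γ ≤ hc) (h0 : 0 ≤ U0) (hbc : 0 ≤ Ubc)
    (hV_a : Va ≤ β + γ - β * γ - α)
    (ga : U0 * ((1 - α) * β * γ - α * (1 - β) * (1 - γ)) + Ubc * (β + γ - β * γ - α) < 0)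
    (hnum : 0 ≤ la ∧ 0 ≤ lb ∧ 0 ≤ lc ∧ ha ≤ 1 / 2 ∧ hb ≤ 1 / 2 ∧ hc ≤ 1 / 2 ∧
      (ha * (1 - lb) * (1 - lc) - (1 - ha) * lb * lc) ≤ 0 ∧ 0 ≤ Va) : False := by
  obtain ⟨hla, hlb, hlc, hha, hhb, hhc, hT, hV⟩ := hnum
  have hT_a : α * (1 - β) * (1 - γ) - (1 - α) * β * γ ≤ ha * (1 - lb) * (1 - lc) - (1 - ha) * lb * lc :=
    Tm_le_box α β γ la ha lb hb lc hc a1 a2 b1 b2 c1 c2 hla hlb hlc (by linarith only [hha]) (by linarith only [hhb])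
      (by linarith only [hhc])
  have h1 : U0 * (α * (1 - β) * (1 - γ) - (1 - α) * β * γ) ≤ 0 :=
    mul_nonpos_of_nonneg_of_nonpos h0 (by linarith only [hT_a, hT])
  have h2 : 0 ≤ Ubc * (β + γ - β * γ - α) := mul_nonneg hbc (by linarith only [hV_a, hV])
  linarith only [ga, h1, h2]

/-- If `T_b⁻ ≤ 0` on the box and `V_b ≥ Vb ≥ 0` (hypothesis), the exchange at `b` cannot fail. [this work] -/
theorem vacBoxV_b_false (α β γ U0 Uac la ha lb hb lc hc Vb : ℝ)
    (a1 : la ≤ α) (a2 : α ≤ ha) (b1 : lb ≤ β) (b2 : β ≤ hb) (c1 : lc ≤ γ) (c2 : γ ≤ hc) (h0 : 0 ≤ U0) (hac : 0 ≤ Uac)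
    (hV_b : Vb ≤ α + γ - α * γ - β)
    (gb : U0 * ((1 - β) * α * γ - β * (1 - α) * (1 - γ)) + Uac * (α + γ - α * γ - β) < 0)
    (hnum : 0 ≤ la ∧ 0 ≤ lb ∧ 0 ≤ lc ∧ ha ≤ 1 / 2 ∧ hb ≤ 1 / 2 ∧ hc ≤ 1 / 2 ∧
      (hb * (1 - la) * (1 - lc) - (1 - hb) * la * lc) ≤ 0 ∧ 0 ≤ Vb) : False := by
  obtain ⟨hla, hlb, hlc, hha, hhb, hhc, hT, hV⟩ := hnum
  exact vacBoxV_a_false β α γ U0 Uac lb hb la ha lc hc Vb b1 b2 a1 a2 c1 c2 h0 hac hV_b (by linarith only [gb])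
    ⟨hlb, hla, hlc, hhb, hha, hhc, hT, hV⟩

/-- If `T_c⁻ ≤ 0` on the box and `V_c ≥ Vc ≥ 0` (hypothesis), the exchange at `c` cannot fail. [this work] -/
theorem vacBoxV_c_false (α β γ U0 Uab la ha lb hb lc hc Vc : ℝ)
    (a1 : la ≤ α) (a2 : α ≤ ha) (b1 : lb ≤ β) (b2 : β ≤ hb) (c1 : lc ≤ γ) (c2 : γ ≤ hc) (h0 : 0 ≤ U0) (hab : 0 ≤ Uab)
    (hV_c : Vc ≤ α + β - α * β - γ)
    (gc : U0 * ((1 - γ) * α * β - γ * (1 - α) * (1 - β)) + Uab * (α + β - α * β - γ) < 0)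
    (hnum : 0 ≤ la ∧ 0 ≤ lb ∧ 0 ≤ lc ∧ ha ≤ 1 / 2 ∧ hb ≤ 1 / 2 ∧ hc ≤ 1 / 2 ∧
      (hc * (1 - la) * (1 - lb) - (1 - hc) * la * lb) ≤ 0 ∧ 0 ≤ Vc) : False := by
  obtain ⟨hla, hlb, hlc, hha, hhb, hhc, hT, hV⟩ := hnum
  exact vacBoxV_a_false γ α β U0 Uab lc hc la ha lb hb Vc c1 c2 a1 a2 b1 b2 h0 hab (by linarith only [hV_c])
    (by linarith only [gc]) ⟨hlc, hla, hlb, hhc, hha, hhb, hT, hV⟩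

end ThreePort

end Summit.CriticalPhenomena.PercolationContinuityZ3.Theorems

end
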